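import Literature.NumberTheory.GaloisRepresentations.LubinTateColemanRelativeBaseNormLawsTwo
import HarnessLib

/-!
# Norm-coherent units of the two-variable local tower: DIAGONAL sequences `(x_n ∈ E_n·K_π^{n+1})_n` ⟷ families `(β_m ∈ 𝒰(E_m·K_π^∞))_m`
# coherent for the norms down the unramified base

De Shalit, *Iwasawa theory of elliptic curves with complex multiplication* (1987), Ch. I §3.8 (the inverse system over the unramified
layers `k′ ⊂ k″ ⊂ ⋯`, vertical arrows `N_{k″/k′}` of (16), limit (17)) and Ch. III §1.2 Lemma (ii) / §1.3: globally the semi-local units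
of the two-variable tower `K(𝔣𝔭^∞𝔭̄^∞)` are an inverse limit along ONE cofinal chain of fields (`F_n`, Rubin's `U_∞ = lim← U(F_n)`),
whose completions at `v` form the DIAGONAL `D_n = E_n·K_π^{n+1}` of the double tower `{E_m·K_π^{n+1}}_{m,n}` (`E_m` the unramified layers).
The series-currency limit of Theorem I.3.7 (`LubinTateColemanTwoVariableLimitTwo`) is indexed by the double tower: families `β_m ∈ 𝒰(E_m·K_π^∞)`
(`RelNormCoherentUnits hπ (E m)`, norm-coherent in the `K_π`-direction) with `N_{E_{m+1}/E_m} β_{m+1} = β_m` (`baseNorm`).  This file identifies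
the two indexings (pure norm bookkeeping, any residue characteristic):

* `RelNormCoherentUnits.baseNorm_add` — iterated coherence `N_{E_{m+j}/E_m} β_{m+j} = β_m`;
* ★ `norm_diagonal_eq` — the diagonal `n ↦ (β_n)_n ∈ 𝒪_{E_n·K_π^{n+1}}` of a baseNorm-coherent family is norm-coherent along `D_n ≤ D_{n'}`;
* ★★★ `existsUnique_baseNormCoherent_of_diagonal` — **every norm-coherent sequence of units along the diagonal `D_0 ≤ D_1 ≤ ⋯` is the diagonal of a
  UNIQUE baseNorm-coherent family** (`β_m` has components `N_{D_{n+m}/E_m·K_π^{n+1}} x_{n+m}`; independence of choices and all coherences by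
  transitivity of norms).  So `𝒰_∞ = lim←_n U(D_n)` (one cofinal chain, as in Rubin/ty2's `SemilocalUnitData₂` (U2)/(U4)) IS the module of
  the limit sequence (17).

Everything PROVED (0 sorry, no named facts, no new definitions).

## References

* E. de Shalit, *Iwasawa theory of elliptic curves with complex multiplication* (1987), Ch. I §3.8 (16)–(17); Ch. III §1.2 Lemma (ii), §1.3. [deShalit1987]
* K. Rubin, Invent. Math. 103 (1991), §4 (p. 36: `U_∞ = lim← U(F)` over the norm maps). [Rubin1991]
-/

noncomputable section

namespace Literature.NumberTheory.GaloisRepresentations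

section TwoVariableDiagonalTwo

open GaloisRepresentations.IsNonarchimedeanLocalField LubinTate ValuativeRel Field

variable {F : Type} [Field F] [ValuativeRel F] [TopologicalSpace F] [IsNonarchimedeanLocalField F]

attribute [local instance] ltNormUniformSpace ltNormIsUniformAddGroup rk1 nF nE fintypeResidueField

variable {π : 𝒪[F]} (hπ : (valuation F).IsUniformizer (π : F))
variable (E : ℕ → IntermediateField F (AlgebraicClosure F)) [∀ m, FiniteDimensional F (E m)] [∀ m, IsGalois F (E m)]
  (hmono : Monotone E)

/-! ### Iterated coherence down the base -/

/-- **`N_{E_{m+j}/E_m} β_{m+j} = β_m`** for a family coherent under the successive norms down the base (transitivity `baseNorm_baseNorm`).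
[cite: deShalit1987, Ch. I §3.8 (16)] -/
theorem RelNormCoherentUnits.baseNorm_add {β : ∀ m, RelNormCoherentUnits hπ (E m)}
    (hβ : ∀ m, (β (m + 1)).baseNorm hπ (hmono (Nat.le_succ m)) = β m) (m j : ℕ) :
    (β (m + j)).baseNorm hπ (hmono (Nat.le_add_right m j)) = β m := by
  induction j with
  | zero =>
    refine RelNormCoherentUnits.ext fun n => Subtype.ext ?_
    rw [RelNormCoherentUnits.coe_val_baseNorm]
    -- `N_{L/L} = id`: the product over the automorphisms fixing everything is the single term `σ = 1`
    classical
    haveI := isGalois_sup_ltField hπ (E (m + 0)) n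
    have h1 := algebraMap_towerNorm_eq_prod (le_refl (E (m + 0) ⊔ ltField π n : IntermediateField F (AlgebraicClosure F)))
      (((β (m + 0)).val n : unitBall (E (m + 0) ⊔ ltField π n : IntermediateField F (AlgebraicClosure F))) :
        (E (m + 0) ⊔ ltField π n : IntermediateField F (AlgebraicClosure F)))
    have hfilter : Finset.univ.filter (fun σ : (E (m + 0) ⊔ ltField π n : IntermediateField F (AlgebraicClosure F)) ≃ₐ[F]
        (E (m + 0) ⊔ ltField π n : IntermediateField F (AlgebraicClosure F)) =>
        ∀ y : (E (m + 0) ⊔ ltField π n : IntermediateField F (AlgebraicClosure F)),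
          σ (IntermediateField.inclusion (le_refl _) y) = IntermediateField.inclusion (le_refl _) y) = {1} := by
      ext σ
      simp only [Finset.mem_filter, Finset.mem_univ, true_and, Finset.mem_singleton]
      constructor
      · intro hσ
        refine AlgEquiv.ext fun y => ?_
        have hy := hσ y
        have e : IntermediateField.inclusion (le_refl _) y = y := Subtype.ext rfl
        rw [e] at hy
        rw [hy, AlgEquiv.one_apply]
      · rintro rfl y
        rfl
    rw [hfilter, Finset.prod_singleton, AlgEquiv.one_apply] at h1
    have e : IntermediateField.inclusion (le_refl (E (m + 0) ⊔ ltField π n : IntermediateField F (AlgebraicClosure F)))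
        (@Algebra.norm (E (m + 0) ⊔ ltField π n : IntermediateField F (AlgebraicClosure F))
          (E (m + 0) ⊔ ltField π n : IntermediateField F (AlgebraicClosure F)) _ _ (towerAlgebra (le_refl _))
          (((β (m + 0)).val n : unitBall (E (m + 0) ⊔ ltField π n : IntermediateField F (AlgebraicClosure F))) :
            (E (m + 0) ⊔ ltField π n : IntermediateField F (AlgebraicClosure F)))) =
        IntermediateField.inclusion (le_refl _) (((β (m + 0)).val n : unitBall (E (m + 0) ⊔ ltField π n :
          IntermediateField F (AlgebraicClosure F))) : (E (m + 0) ⊔ ltField π n : IntermediateField F (AlgebraicClosure F))) := by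
      rw [h1]; exact Subtype.ext rfl
    exact IntermediateField.inclusion_injective _ e
  | succ j ih =>
    rw [← ih, ← hβ (m + j), RelNormCoherentUnits.baseNorm_baseNorm]
    rfl

/-! ### The diagonal of a baseNorm-coherent family is norm-coherent -/

omit [∀ m, FiniteDimensional F (E m)] [∀ m, IsGalois F (E m)] in
include hπ hmono in
/-- The diagonal tower `D_n = E_n·K_π^{n+1}` is increasing. [cite: deShalit1987, Ch. III §1.3] -/
theorem sup_ltField_mono {n n' : ℕ} (h : n ≤ n') :
    (E n ⊔ ltField π n : IntermediateField F (AlgebraicClosure F)) ≤ E n' ⊔ ltField π n' :=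
  sup_le_sup (hmono h) (ltField_mono hπ h)

omit [∀ m, FiniteDimensional F (E m)] [∀ m, IsGalois F (E m)] in
include hπ hmono in
/-- `E_m·K_π^{n+1} ≤ D_{n+m}`. [cite: deShalit1987, Ch. III §1.3] -/
theorem sup_ltField_le_diagonal (m n : ℕ) :
    (E m ⊔ ltField π n : IntermediateField F (AlgebraicClosure F)) ≤ E (n + m) ⊔ ltField π (n + m) :=
  sup_le_sup (hmono (Nat.le_add_left m n)) (ltField_mono hπ (Nat.le_add_right n m))

/-- ★ **The diagonal of a baseNorm-coherent family is norm-coherent along `D_n ≤ D_{n'}`**: `N_{D_{n'}/D_n}((β_{n'})_{n'}) = (β_n)_n`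
(factor `D_n ≤ E_{n'}·K_π^{n+1} ≤ D_{n'}`: first the `K_π`-direction coherence of `β_{n'}`, then `N_{E_{n'}/E_n} β_{n'} = β_n`).
[cite: deShalit1987, Ch. I §3.8 (16); Ch. III §1.2 Lemma (ii)] -/
theorem norm_diagonal_eq {β : ∀ m, RelNormCoherentUnits hπ (E m)} (hβ : ∀ m, (β (m + 1)).baseNorm hπ (hmono (Nat.le_succ m)) = β m)
    {n n' : ℕ} (h : n ≤ n') :
    @Algebra.norm (E n ⊔ ltField π n : IntermediateField F (AlgebraicClosure F)) (E n' ⊔ ltField π n' : IntermediateField F (AlgebraicClosure F))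
        _ _ (towerAlgebra (sup_ltField_mono hπ E hmono h))
        (((β n').val n' : unitBall (E n' ⊔ ltField π n' : IntermediateField F (AlgebraicClosure F))) :
          (E n' ⊔ ltField π n' : IntermediateField F (AlgebraicClosure F))) =
      (((β n).val n : unitBall (E n ⊔ ltField π n : IntermediateField F (AlgebraicClosure F))) :
        (E n ⊔ ltField π n : IntermediateField F (AlgebraicClosure F))) := by
  obtain ⟨j, rfl⟩ := Nat.exists_eq_add_of_le h
  rw [← towerNorm_towerNorm (sup_le_sup_right (hmono h) (ltField π n) : (E n ⊔ ltField π n : IntermediateField F (AlgebraicClosure F)) ≤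
      E (n + j) ⊔ ltField π n) (sup_le_sup_left (ltField_mono hπ h) (E (n + j))), (β (n + j)).coherent n (n + j) h,
    ← RelNormCoherentUnits.coe_val_baseNorm hπ (hmono h), RelNormCoherentUnits.baseNorm_add hπ E hmono hβ n j]

/-! ### Every diagonal norm-coherent sequence comes from a unique baseNorm-coherent family -/

set_option maxHeartbeats 800000 in
/-- ★★★ **Diagonal sequences ⟷ baseNorm-coherent families**: for every sequence of units `x_n ∈ 𝒪_{D_n}`, `D_n = E_n·K_π^{n+1}`, which is
norm-coherent along `D_0 ≤ D_1 ≤ ⋯`, there is a UNIQUE family `β_m ∈ 𝒰(E_m·K_π^∞)` with `N_{E_{m+1}/E_m} β_{m+1} = β_m` whose diagonal is `x`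
(components `(β_m)_n = N_{D_{n+m}/E_m·K_π^{n+1}} x_{n+m}`).  Thus the units of the two-variable local tower taken along ONE cofinal chain
(Rubin's `U_∞ = lim←_n U(F_n)`) are the baseNorm-coherent families of the limit sequence (17).
[cite: deShalit1987, Ch. I §3.8 (16)–(17); Ch. III §1.2 Lemma (ii), §1.3] -/
theorem existsUnique_baseNormCoherent_of_diagonal
    (x : ∀ n, unitBall (E n ⊔ ltField π n : IntermediateField F (AlgebraicClosure F)))
    (hx1 : ∀ n, ‖((x n : unitBall (E n ⊔ ltField π n : IntermediateField F (AlgebraicClosure F))) :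
      (E n ⊔ ltField π n : IntermediateField F (AlgebraicClosure F)))‖ = 1)
    (hx : ∀ n n' (h : n ≤ n'),
      @Algebra.norm (E n ⊔ ltField π n : IntermediateField F (AlgebraicClosure F)) (E n' ⊔ ltField π n' : IntermediateField F (AlgebraicClosure F))
          _ _ (towerAlgebra (sup_ltField_mono hπ E hmono h))
          ((x n' : unitBall (E n' ⊔ ltField π n' : IntermediateField F (AlgebraicClosure F))) :
            (E n' ⊔ ltField π n' : IntermediateField F (AlgebraicClosure F))) =
        ((x n : unitBall (E n ⊔ ltField π n : IntermediateField F (AlgebraicClosure F))) :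
          (E n ⊔ ltField π n : IntermediateField F (AlgebraicClosure F)))) :
    ∃! β : ∀ m, RelNormCoherentUnits hπ (E m),
      (∀ m, (β (m + 1)).baseNorm hπ (hmono (Nat.le_succ m)) = β m) ∧ ∀ n, (β n).val n = x n := by
  haveI : ∀ k, IsGalois F (E k ⊔ ltField π k : IntermediateField F (AlgebraicClosure F)) := fun k => isGalois_sup_ltField hπ (E k) k
  -- the general component `N_{D_N/E_m K_n} x_N` does not depend on `N ≥ n + m`
  have hindep : ∀ m n N (hN : n + m ≤ N),
      @Algebra.norm (E m ⊔ ltField π n : IntermediateField F (AlgebraicClosure F)) (E N ⊔ ltField π N : IntermediateField F (AlgebraicClosure F))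
          _ _ (towerAlgebra ((sup_ltField_le_diagonal hπ E hmono m n).trans (sup_ltField_mono hπ E hmono hN)))
          ((x N : unitBall (E N ⊔ ltField π N : IntermediateField F (AlgebraicClosure F))) :
            (E N ⊔ ltField π N : IntermediateField F (AlgebraicClosure F))) =
        @Algebra.norm (E m ⊔ ltField π n : IntermediateField F (AlgebraicClosure F))
          (E (n + m) ⊔ ltField π (n + m) : IntermediateField F (AlgebraicClosure F)) _ _ (towerAlgebra (sup_ltField_le_diagonal hπ E hmono m n))
          ((x (n + m) : unitBall (E (n + m) ⊔ ltField π (n + m) : IntermediateField F (AlgebraicClosure F))) :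
            (E (n + m) ⊔ ltField π (n + m) : IntermediateField F (AlgebraicClosure F))) := by
    intro m n N hN
    rw [← towerNorm_towerNorm (sup_ltField_le_diagonal hπ E hmono m n) (sup_ltField_mono hπ E hmono hN), hx _ _ hN]
  -- existence
  obtain ⟨β, hβ⟩ : ∃ β : ∀ m, RelNormCoherentUnits hπ (E m), ∀ m n,
      (((β m).val n : unitBall (E m ⊔ ltField π n : IntermediateField F (AlgebraicClosure F))) :
        (E m ⊔ ltField π n : IntermediateField F (AlgebraicClosure F))) =
        @Algebra.norm (E m ⊔ ltField π n : IntermediateField F (AlgebraicClosure F))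
          (E (n + m) ⊔ ltField π (n + m) : IntermediateField F (AlgebraicClosure F)) _ _ (towerAlgebra (sup_ltField_le_diagonal hπ E hmono m n))
          ((x (n + m) : unitBall (E (n + m) ⊔ ltField π (n + m) : IntermediateField F (AlgebraicClosure F))) :
            (E (n + m) ⊔ ltField π (n + m) : IntermediateField F (AlgebraicClosure F))) := by
    refine ⟨fun m =>
      { val := fun n => ⟨@Algebra.norm (E m ⊔ ltField π n : IntermediateField F (AlgebraicClosure F))
            (E (n + m) ⊔ ltField π (n + m) : IntermediateField F (AlgebraicClosure F)) _ _ (towerAlgebra (sup_ltField_le_diagonal hπ E hmono m n))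
            ((x (n + m) : unitBall (E (n + m) ⊔ ltField π (n + m) : IntermediateField F (AlgebraicClosure F))) :
              (E (n + m) ⊔ ltField π (n + m) : IntermediateField F (AlgebraicClosure F))),
          (mem_unitBall_iff _).mpr (le_of_eq (norm_towerNorm_eq_one _ (hx1 (n + m))))⟩
        norm_eq_one := fun n => norm_towerNorm_eq_one _ (hx1 (n + m))
        coherent := fun n n' hnn' => ?_ }, fun m n => rfl⟩
    -- coherence in the `K_π`-direction, through `D_{n'+m}`
    change @Algebra.norm (E m ⊔ ltField π n : IntermediateField F (AlgebraicClosure F)) (E m ⊔ ltField π n' : IntermediateField F (AlgebraicClosure F))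
        _ _ (towerAlgebra (sup_le_sup_left (ltField_mono hπ hnn') (E m)))
        (@Algebra.norm (E m ⊔ ltField π n' : IntermediateField F (AlgebraicClosure F))
          (E (n' + m) ⊔ ltField π (n' + m) : IntermediateField F (AlgebraicClosure F)) _ _ (towerAlgebra (sup_ltField_le_diagonal hπ E hmono m n'))
          ((x (n' + m) : unitBall (E (n' + m) ⊔ ltField π (n' + m) : IntermediateField F (AlgebraicClosure F))) :
            (E (n' + m) ⊔ ltField π (n' + m) : IntermediateField F (AlgebraicClosure F)))) =
      @Algebra.norm (E m ⊔ ltField π n : IntermediateField F (AlgebraicClosure F))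
        (E (n + m) ⊔ ltField π (n + m) : IntermediateField F (AlgebraicClosure F)) _ _ (towerAlgebra (sup_ltField_le_diagonal hπ E hmono m n))
        ((x (n + m) : unitBall (E (n + m) ⊔ ltField π (n + m) : IntermediateField F (AlgebraicClosure F))) :
          (E (n + m) ⊔ ltField π (n + m) : IntermediateField F (AlgebraicClosure F)))
    rw [towerNorm_towerNorm, ← hindep m n (n' + m) (Nat.add_le_add_right hnn' m)]
  refine ⟨β, ⟨fun m => ?_, fun n => ?_⟩, ?_⟩
  · -- coherence down the base, through `D_{n+m+1}`
    refine RelNormCoherentUnits.ext fun n => Subtype.ext ?_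
    rw [RelNormCoherentUnits.coe_val_baseNorm, hβ, hβ, towerNorm_towerNorm]
    exact hindep m n (n + (m + 1)) (Nat.le_succ _)
  · -- the diagonal
    apply Subtype.ext
    rw [hβ]
    have h1 := hindep n n (n + n) le_rfl
    rw [← h1]
    exact hx n (n + n) (Nat.le_add_right n n)
  · -- uniqueness
    rintro β' ⟨hβ', hβ'x⟩
    funext m
    refine RelNormCoherentUnits.ext fun n => Subtype.ext ?_
    rw [hβ, ← hβ'x (n + m), ← RelNormCoherentUnits.baseNorm_add hπ E hmono hβ' m n]
    -- `(N_{E_{m+n}/E_m} β'_{m+n})_n = N_{E_{m+n}K_n/E_mK_n}((β'_{m+n})_n)` and `(β'_{m+n})_n = N((β'_{m+n})_{n+m})`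
    rw [RelNormCoherentUnits.coe_val_baseNorm, ← (β' (m + n)).coherent n (m + n) (Nat.le_add_left n m), towerNorm_towerNorm]
    -- the indices `m + n` and `n + m`
    have e : ∀ (a b : ℕ) (hab : a = b) (hle : (E m ⊔ ltField π n : IntermediateField F (AlgebraicClosure F)) ≤ E a ⊔ ltField π a)
        (hle' : (E m ⊔ ltField π n : IntermediateField F (AlgebraicClosure F)) ≤ E b ⊔ ltField π b),
        @Algebra.norm (E m ⊔ ltField π n : IntermediateField F (AlgebraicClosure F)) (E a ⊔ ltField π a : IntermediateField F (AlgebraicClosure F))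
            _ _ (towerAlgebra hle)
            (((β' a).val a : unitBall (E a ⊔ ltField π a : IntermediateField F (AlgebraicClosure F))) :
              (E a ⊔ ltField π a : IntermediateField F (AlgebraicClosure F))) =
          @Algebra.norm (E m ⊔ ltField π n : IntermediateField F (AlgebraicClosure F)) (E b ⊔ ltField π b : IntermediateField F (AlgebraicClosure F))
            _ _ (towerAlgebra hle')
            (((β' b).val b : unitBall (E b ⊔ ltField π b : IntermediateField F (AlgebraicClosure F))) :
              (E b ⊔ ltField π b : IntermediateField F (AlgebraicClosure F))) := by
      intro a b hab hle hle'
      subst hab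
      rfl
    exact e (m + n) (n + m) (Nat.add_comm m n) _ _

end TwoVariableDiagonalTwo

end Literature.NumberTheory.GaloisRepresentations
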